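import Mathlib
import Summits.CriticalPhenomena.SAWScalingLimit.Theorems.SAWDefectDecoherenceConjugateClassNegligibleSums
import Literature.Barriers.CriticalPhenomena.ParafermionicHalfCauchyRiemann
import Literature.Probability.RandomPlanarGeometry.HexParafermionProofs
import Literature.Probability.RandomPlanarGeometry.ConformalMap
import Literature.Probability.RandomPlanarGeometry.PlanarDomains
import HarnessLib

/-!
# Crux `HexObservableLimitR` (stmt-CriticalPhenomena-14003), line `Ideator1Sketch` — stub `stub_reindex`

Registered stub of the lead skeleton `Cruxes/HexObservableLimitR/Lines/Ideator1Sketch.lean`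
(composition `HexObservableLimitR_of`). Target file: `Summits/CriticalPhenomena/SAWScalingLimit/Theorems/SAWDefectDecoherenceHexObservableLimitRReindex.lean`.

Contents (namespace `Summit.CriticalPhenomena.SAWScalingLimit.Theorems.HexObservableLimitR`):
* `finsum_midEdges_eq_sum_pairs` — a function on mid-edges of the hexagonal domain `Λ` vanishing on
  the mid-edges without both endpoints in `Λ` has `finsum` equal to its sum over the black→white
  ordered pairs inside `Λ` (bipartiteness: each interior edge has exactly one black end);
* `stub_reindex` — eventually in `δ ↓ 0`, the boundary mid-edges of `Λ_δ` carry no `ψ`-mass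
  (`tsupport ψ` has a compact thickening inside `Ω`, exhausted by the rescaled `Λ_δ`), so the crux's
  normalised `finsum` over all mid-edges is the pair sum.
-/

noncomputable section

namespace Summit.CriticalPhenomena.SAWScalingLimit.Theorems.HexObservableLimitR

open Literature.Probability.RandomPlanarGeometry Literature.Probability.RandomPlanarGeometry.SAW
open Literature.Probability.LatticeModels Literature.Barriers.CriticalPhenomena
open Literature.Barriers.CriticalPhenomena.HexGreen
open Summit.CriticalPhenomena.SAWScalingLimit.Theorems.ConjugateClassNegligibleSynthesis
open Summit.CriticalPhenomena.SAWScalingLimit.Theorems.MassRatio.Negative (hexDomainMidEdges_finite)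
open scoped BigOperators Topology ComplexConjugate
open Filter MeasureTheory Set Metric

/-- **Mid-edges ↔ black→white pairs.** If `f` vanishes on every mid-edge of the domain `Λ` not
having both endpoints in `Λ`, then the `finsum` of `f` over the mid-edges of `Λ` equals the sum of
`f {v, t}` over the black→white ordered pairs `(v, t)`, `v, t ∈ Λ`, `v` black, `v ∼ t`: the honeycomb
lattice is bipartite, so each interior edge has exactly one black endpoint. [folklore] -/
theorem finsum_midEdges_eq_sum_pairs {M : Type*} [AddCommMonoid M] (Λ : Finset HexVertex)
    (f : Sym2 HexVertex → M)
    (hf : ∀ e ∈ hexDomainMidEdges Λ, f e ≠ 0 → ∀ v ∈ e, v ∈ Λ) :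
    ∑ᶠ e ∈ hexDomainMidEdges Λ, f e =
      ∑ p ∈ (((Λ.filter fun v => v.2 = 0) ×ˢ Λ).filter (fun p => hexGraph.Adj p.1 p.2)),
        f s(p.1, p.2) := by
  classical
  rw [finsum_mem_eq_finite_toFinset_sum f (hexDomainMidEdges_finite Λ),
    ← Finset.sum_image (f := f) (injOn_sym2_pairFinset Λ)]
  symm
  refine Finset.sum_subset ?_ ?_
  · intro e he
    rw [Finset.mem_image] at he
    obtain ⟨p, hp, rfl⟩ := he
    rw [mem_pairFinset] at hp
    rw [Set.Finite.mem_toFinset]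
    exact ⟨(SimpleGraph.mem_edgeSet _).2 hp.2.2.2, p.1, Sym2.mem_mk_left _ _, hp.1⟩
  · intro e he hni
    by_contra hne
    apply hni
    rw [Set.Finite.mem_toFinset] at he
    have hboth := hf e he hne
    obtain ⟨hedge, -⟩ := he
    induction e using Sym2.ind with
    | h x y =>
      rw [SimpleGraph.mem_edgeSet] at hedge
      have hx : x ∈ Λ := hboth x (Sym2.mem_mk_left x y)
      have hy : y ∈ Λ := hboth y (Sym2.mem_mk_right x y)
      rw [Finset.mem_image]
      by_cases hx0 : x.2 = 0
      · exact ⟨(x, y), mem_pairFinset.2 ⟨hx, hx0, hy, hedge⟩, rfl⟩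
      · have hy0 : y.2 = 0 :=
          (by decide : ∀ i j : Fin 2, ¬i = 0 → i ≠ j → j = 0) _ _ hx0 (snd_ne_of_adj hedge)
        exact ⟨(y, x), mem_pairFinset.2 ⟨hy, hy0, hx, hedge.symm⟩, Sym2.eq_swap⟩

/-- **Re-indexing.** For a test function `ψ ∈ C_c(Ω)` and an admissible family exhausting the
compacts of `Ω`, eventually every mid-edge of `Λ_δ` whose rescaled midpoint lies in `supp ψ` is an
interior mid-edge, and the interior mid-edges are parametrised once each by the black→white pairs;
hence the crux's normalised `finsum` equals the pair sum of `ψ(δe) · δ² F_δ(e)/F_δ(b_δ)`. -/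
theorem stub_reindex (D : DobrushinDomain) (Λ : ℝ → Finset HexVertex) (a b : ℝ → Sym2 HexVertex)
    (ψ : ℂ → ℂ)
    (hexh : ∀ K : Set ℂ, IsCompact K → K ⊆ D.carrier → ∀ᶠ δ : ℝ in 𝓝[>] 0,
      ∀ v : HexVertex, (δ : ℂ) * hexCenter v ∈ K → v ∈ Λ δ)
    (_hψ : Continuous ψ) (hψs : HasCompactSupport ψ) (hψΩ : tsupport ψ ⊆ D.carrier) :
    ∀ᶠ δ : ℝ in 𝓝[>] 0,
      (δ : ℂ) ^ 2 * (∑ᶠ e ∈ hexDomainMidEdges (Λ δ),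
          ψ ((δ : ℂ) * hexMidpoint e) *
            hexParafermionicObservable (Λ δ) (a δ) hexCriticalFugacity (5 / 8) e) /
        hexParafermionicObservable (Λ δ) (a δ) hexCriticalFugacity (5 / 8) (b δ) =
      ∑ p ∈ (((Λ δ).filter fun v => v.2 = 0) ×ˢ Λ δ).filter (fun p => hexGraph.Adj p.1 p.2),
        ψ ((δ : ℂ) * hexMidpoint s(p.1, p.2)) *
          ((δ : ℂ) ^ 2 * hexParafermionicObservable (Λ δ) (a δ) hexCriticalFugacity (5 / 8) s(p.1, p.2) /
            hexParafermionicObservable (Λ δ) (a δ) hexCriticalFugacity (5 / 8) (b δ)) := by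
  -- a compact closed thickening of `tsupport ψ` inside `Ω`, exhausted by the rescaled `Λ_δ`
  obtain ⟨r, hr, hrΩ⟩ := hψs.isCompact.exists_cthickening_subset_open D.isOpen hψΩ
  have hK : IsCompact (cthickening r (tsupport ψ)) := hψs.isCompact.cthickening
  filter_upwards [hexh _ hK hrΩ, Ioc_mem_nhdsGT hr] with δ hδ hδr
  have hδ0 : 0 ≤ δ := hδr.1.le
  have key := finsum_midEdges_eq_sum_pairs (Λ δ)
    (fun e => ψ ((δ : ℂ) * hexMidpoint e) *
      hexParafermionicObservable (Λ δ) (a δ) hexCriticalFugacity (5 / 8) e) (by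
    -- a mid-edge carrying `ψ`-mass has both (rescaled) endpoints within `δ/2 ≤ r` of `tsupport ψ`
    intro e he hne
    obtain ⟨hedge, -⟩ := he
    induction e using Sym2.ind with
    | h x y =>
      rw [SimpleGraph.mem_edgeSet] at hedge
      have hψne : ψ ((δ : ℂ) * hexMidpoint s(x, y)) ≠ 0 := fun h0 => hne (by rw [h0, zero_mul])
      have hmem : (δ : ℂ) * hexMidpoint s(x, y) ∈ tsupport ψ :=
        not_not.1 fun h => hψne (image_eq_zero_of_notMem_tsupport h)
      have hdx := dist_mid_center_le hδ0 hedge (δ := δ)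
      have hdy := dist_mid_center_le' hδ0 hedge (δ := δ)
      have hx : x ∈ Λ δ := hδ x (mem_of_dist_le_of_mem_tsupport Subset.rfl hmem
        (by rw [dist_comm]; linarith [hδr.2]))
      have hy : y ∈ Λ δ := hδ y (mem_of_dist_le_of_mem_tsupport Subset.rfl hmem
        (by rw [dist_comm]; linarith [hδr.2]))
      intro v hv
      rcases Sym2.mem_iff.1 hv with rfl | rfl
      exacts [hx, hy])
  rw [key, Finset.mul_sum, Finset.sum_div]
  refine Finset.sum_congr rfl fun p _ => ?_
  ring

end Summit.CriticalPhenomena.SAWScalingLimit.Theorems.HexObservableLimitR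

end
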